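import Summits.CriticalPhenomena.PercolationContinuityZ3.Theorems.SahiMasterFamilyAlphaAlpha

/-!
# Terminal triples: Lemma L3, part 1 — section helpers and the mixed cases

Companion of `SahiMasterFamilyAlphaAlpha.lean` (unit `prim-master-conj`; terminal analysis of (T), paper
STRUCTURE-PROOF.md §11 (L3), verified VERIFICATION-gen3.md).  Part 1 of L3: helpers on sections
(`secAt_comm`, `not_affects_of_secAt`, …), the downward induction `conf_mem_of_pivot_exclusion`, and the MIXED CASES
`reduce_to_alpha_alpha`: with an N0 coordinate `e ∈ esupp A ∩ esupp B`, it is impossible that the `e`-minor at level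
`v` is realised by the section pair `(A, B)` while the other `A`-section ignores `esupp C` (reduction to Lemma (αα)
for `(A, C, B)` at a coordinate of `esupp A ∩ esupp C`).  Everything here is proved; axioms standard. [this work]
-/

noncomputable section

open scoped Classical

namespace Summit.CriticalPhenomena.PercolationContinuityZ3.Theorems

open Finset Function
open Literature.Probability.Percolation (DeterminedBy determinedBy_iff)
open Literature.Probability.LatticeModels.Kahn2022 (Affects)

variable {ι : Type*} [Fintype ι]

/-! ### Helpers -/

omit [Fintype ι] in
/-- Sections at different coordinates commute. [folklore] -/
theorem secAt_comm {X : Set (Set ι)} {e s : ι} (hes : e ≠ s) (b b' : Bool) :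
    secAt e b (secAt s b' X) = secAt s b' (secAt e b X) := by
  ext ω
  simp only [mem_secAt]
  have : forceAt s b' (forceAt e b ω) = forceAt e b (forceAt s b' ω) := by
    cases b <;> cases b' <;> simp only [forceAt, cond_true, cond_false]
    · rw [Set.sdiff_sdiff_comm]
    · ext i; simp only [Set.mem_sdiff, Set.mem_insert_iff, Set.mem_singleton_iff]
      constructor
      · rintro (rfl | ⟨hi, hie⟩)
        · exact ⟨Or.inl rfl, hes.symm⟩
        · exact ⟨Or.inr hi, hie⟩
      · rintro ⟨rfl | hi, hie⟩
        · exact Or.inl rfl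
        · exact Or.inr ⟨hi, hie⟩
    · ext i; simp only [Set.mem_sdiff, Set.mem_insert_iff, Set.mem_singleton_iff]
      constructor
      · rintro ⟨rfl | hi, his⟩
        · exact Or.inl rfl
        · exact Or.inr ⟨hi, his⟩
      · rintro (rfl | ⟨hi, his⟩)
        · exact ⟨Or.inl rfl, hes⟩
        · exact ⟨Or.inr hi, his⟩
    · exact Set.insert_comm s e ω
  rw [this]

omit [Fintype ι] in
/-- An increasing event is contained in its contraction. [folklore] -/
theorem subset_secAt_true {X : Set (Set ι)} (hX : IsUpperSet X) (s : ι) : X ⊆ secAt s true X := fun ω hω => by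
  rw [mem_secAt]; simp only [forceAt, cond_true]; exact hX (Set.subset_insert s ω) hω

omit [Fintype ι] in
/-- A coordinate affecting neither `t`-section does not affect the event (`e ≠ t`). [folklore] -/
theorem not_affects_of_secAt {X : Set (Set ι)} {e t : ι} (het : e ≠ t) (h1 : ¬ Affects (secAt t true X) e)
    (h0 : ¬ Affects (secAt t false X) e) : ¬ Affects X e := by
  rintro ⟨ω, hω, heω⟩
  by_cases ht : t ∈ ω
  · exact h1 ⟨ω, by rwa [mem_secAt_true_iff_of_mem ht],
      by rwa [mem_secAt_true_iff_of_mem (Set.mem_insert_of_mem e ht)]⟩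
  · refine h0 ⟨ω, by rwa [mem_secAt_false_iff_of_notMem ht], ?_⟩
    rwa [mem_secAt_false_iff_of_notMem (show t ∉ insert e ω from fun h => ?_)]
    rcases h with h | h
    · exact het h.symm
    · exact ht h

/-- An event with empty essential support is trivial. [folklore] -/
theorem eq_empty_or_univ_of_esupp_eq_empty {X : Set (Set ι)} (hX : IsUpperSet X) (h : esupp X = ∅) :
    X = ∅ ∨ X = Set.univ := by
  by_cases hne : X.Nonempty
  · right
    refine Set.eq_univ_of_forall fun ω => (mem_iff_of_inter_esupp_eq hX (ω' := Set.univ) ?_).2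
      (univ_mem_of_nonempty hX hne)
    rw [h]; simp
  · exact Or.inl (Set.not_nonempty_iff_eq_empty.1 hne)

omit [Fintype ι] in
/-- If both `e`-sections of `X` agree then `e` does not affect `X`. [folklore] -/
theorem not_affects_of_secAt_eq {X : Set (Set ι)} {e : ι} (h : secAt e true X = secAt e false X) :
    ¬ Affects X e := by
  rintro ⟨ω, hω, heω⟩
  have heω' : e ∉ ω := fun he => hω (by rwa [Set.insert_eq_of_mem he] at heω)
  have h1 : ω ∈ secAt e true X := by rw [mem_secAt]; simpa only [forceAt, cond_true] using heω
  rw [h, mem_secAt_false_iff_of_notMem heω'] at h1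
  exact hω h1

/-- **Downward induction on configurations.**  `C` increasing nonempty, `R` a set invisible to `C`, `esupp C = P ∪ Q`;
if `R ∪ Y` lies in `S0` and `S1` whenever `P ⊆ Y ⊆ esupp C`, no configuration of `S0` is `t`-pivotal for `C` for
`t ∈ E0`, likewise `S1`/`E1`, and `Q ⊆ E0 ∪ E1`, then the configuration `P` lies in `C`. [this work] -/
theorem conf_mem_of_pivot_exclusion {C : Set (Set ι)} (hC : IsUpperSet C) (hCne : C.Nonempty) (R : Set ι)
    (hR : ∀ Y : Set ι, (R ∪ Y ∈ C ↔ Y ∈ C)) (P Q : Finset ι) (hPQ : esupp C = P ∪ Q)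
    (S0 S1 : Set (Set ι)) (E0 E1 : Finset ι)
    (hm0 : ∀ Y : Set ι, Y ⊆ ↑(esupp C) → (↑P : Set ι) ⊆ Y → R ∪ Y ∈ S0)
    (hm1 : ∀ Y : Set ι, Y ⊆ ↑(esupp C) → (↑P : Set ι) ⊆ Y → R ∪ Y ∈ S1)
    (hp0 : ∀ t ∈ E0, ∀ ω ∈ S0, ω ∉ C → insert t ω ∉ C) (hp1 : ∀ t ∈ E1, ∀ ω ∈ S1, ω ∉ C → insert t ω ∉ C)
    (hsplit : ∀ t ∈ Q, t ∈ E0 ∨ t ∈ E1) : (↑P : Set ι) ∈ C := by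
  have step : ∀ σ : Finset ι, σ ⊆ Q → (↑(P ∪ (Q \ σ)) : Set ι) ∈ C := by
    intro σ
    induction σ using Finset.induction_on with
    | empty =>
      intro _
      rw [Finset.sdiff_empty, ← hPQ]
      exact mem_of_esupp_subset hC hCne subset_rfl
    | insert t σ htσ ih =>
      intro hsub
      have htQ : t ∈ Q := hsub (mem_insert_self t σ)
      have hσ : σ ⊆ Q := fun i hi => hsub (mem_insert_of_mem hi)
      have hprev := ih hσ
      set Y : Set ι := ↑(P ∪ (Q \ insert t σ)) with hYdef
      have heq : (↑(P ∪ (Q \ σ)) : Set ι) = insert t Y := by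
        ext i
        simp only [hYdef, mem_coe, mem_union, mem_sdiff, Finset.mem_insert, Set.mem_insert_iff, not_or]
        constructor
        · rintro (hi | ⟨hiQ, hiσ⟩)
          · exact Or.inr (Or.inl hi)
          · by_cases hit : i = t
            · exact Or.inl hit
            · exact Or.inr (Or.inr ⟨hiQ, hit, hiσ⟩)
        · rintro (rfl | hi | ⟨hiQ, -, hiσ⟩)
          · exact Or.inr ⟨htQ, htσ⟩
          · exact Or.inl hi
          · exact Or.inr ⟨hiQ, hiσ⟩
      rw [heq] at hprev
      by_contra hY
      have hYC : Y ⊆ ↑(esupp C) := by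
        intro i hi
        simp only [hYdef, mem_coe, mem_union, mem_sdiff] at hi
        rw [hPQ, mem_coe, mem_union]
        rcases hi with hi | ⟨hi, -⟩
        · exact Or.inl hi
        · exact Or.inr hi
      have hPY : (↑P : Set ι) ⊆ Y := by
        intro i hi; simp only [hYdef, mem_coe, mem_union]; exact Or.inl (mem_coe.1 hi)
      have hRY : R ∪ Y ∉ C := fun h => hY ((hR Y).1 h)
      have hRY' : insert t (R ∪ Y) ∈ C := by rw [← Set.union_insert]; exact (hR _).2 hprev
      rcases hsplit t htQ with ht | ht
      · exact hp0 t ht _ (hm0 Y hYC hPY) hRY hRY'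
      · exact hp1 t ht _ (hm1 Y hYC hPY) hRY hRY'
  have := step Q subset_rfl
  rwa [Finset.sdiff_self, Finset.union_empty] at this

/-! ### The mixed cases: reduction to Lemma (αα) -/

/-- **Mixed cases of L3.**  With an N0 coordinate `e ∈ esupp A ∩ esupp B`, it is impossible that the `e`-minor at
level `v` is realised by the section pair `(A, B)` while the other `A`-section ignores `esupp C`: the configuration
`esupp B ∩ esupp C` would lie in `C`, every coordinate `s ∈ esupp A ∩ esupp C` would be N0 for `(A, C)` with both
`s`-minors realised by the `(A, C)`-section pairs, and Lemma (αα) for `(A, C, B)` applies. [this work] -/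
theorem reduce_to_alpha_alpha {A B C : Set (Set ι)} (hA : IsUpperSet A) (hB : IsUpperSet B) (hC : IsUpperSet C)
    (hAB : (esupp A ∩ esupp B).Nonempty) (hAC : (esupp A ∩ esupp C).Nonempty)
    (hprivA : esupp A ⊆ esupp B ∪ esupp C) (hprivB : esupp B ⊆ esupp A ∪ esupp C)
    (hprivC : esupp C ⊆ esupp A ∪ esupp B) (hcommon : ∀ i, i ∈ esupp A → i ∈ esupp B → i ∉ esupp C)
    (hNSA : ∀ s ∈ esupp A, ({s} : Set ι) ∉ A) (hNSB : ∀ s ∈ esupp B, ({s} : Set ι) ∉ B)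
    (hNSC : ∀ s ∈ esupp C, ({s} : Set ι) ∉ C)
    (hmin : ∀ i ∈ esupp A ∪ esupp B ∪ esupp C, ∀ b : Bool, SuppZeroFlag 3 ![secAt i b A, secAt i b B, secAt i b C])
    {e : ι} (heA : e ∈ esupp A) (heB : e ∈ esupp B) (hA0 : Set.univ \ {e} ∈ A) (hB0 : Set.univ \ {e} ∈ B)
    (v : Bool) (hα : ZVia (secAt e v A) (secAt e v B) C) (hβ : Disjoint (esupp (secAt e (!v) A)) (esupp C)) :
    False := by
  have heC : e ∉ esupp C := hcommon e heA heB
  set IAB := esupp A ∩ esupp B with hIAB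
  set IAC := esupp A ∩ esupp C with hIAC
  set IBC := esupp B ∩ esupp C with hIBC
  have hAvu : IsUpperSet (secAt e v A) := isUpperSet_secAt e v hA
  have hBvu : IsUpperSet (secAt e v B) := isUpperSet_secAt e v hB
  have hA'u : IsUpperSet (secAt e (!v) A) := isUpperSet_secAt e (!v) hA
  have hAne : A.Nonempty := ⟨_, hA0⟩
  have hBne : B.Nonempty := ⟨_, hB0⟩
  have hAnu : A ≠ Set.univ := (nonempty_of_esupp_nonempty ⟨e, heA⟩).2
  have hCne : C.Nonempty := by
    obtain ⟨i, hi⟩ := hAC; exact (nonempty_of_esupp_nonempty ⟨i, (mem_inter.1 hi).2⟩).1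
  have hCnu : C ≠ Set.univ := by
    obtain ⟨i, hi⟩ := hAC; exact (nonempty_of_esupp_nonempty ⟨i, (mem_inter.1 hi).2⟩).2
  obtain ⟨dABv, pav, pbv⟩ := zVia_pivotal hAvu hBvu hC hα
  have esA : esupp A = IAB ∪ IAC := by
    ext f; rw [mem_union, hIAB, hIAC, mem_inter, mem_inter]
    constructor
    · intro hf
      rcases mem_union.1 (hprivA hf) with h | h
      · exact Or.inl ⟨hf, h⟩
      · exact Or.inr ⟨hf, h⟩
    · rintro (⟨h, -⟩ | ⟨h, -⟩) <;> exact h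
  have esB : esupp B = IAB ∪ IBC := by
    ext f; rw [mem_union, hIAB, hIBC, mem_inter, mem_inter]
    constructor
    · intro hf
      rcases mem_union.1 (hprivB hf) with h | h
      · exact Or.inl ⟨h, hf⟩
      · exact Or.inr ⟨hf, h⟩
    · rintro (⟨-, h⟩ | ⟨h, -⟩) <;> exact h
  have esC : esupp C = IAC ∪ IBC := by
    ext f; rw [mem_union, hIAC, hIBC, mem_inter, mem_inter]
    constructor
    · intro hf
      rcases mem_union.1 (hprivC hf) with h | h
      · exact Or.inl ⟨h, hf⟩
      · exact Or.inr ⟨h, hf⟩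
    · rintro (⟨-, h⟩ | ⟨-, h⟩) <;> exact h
  have hIAC_B : ∀ s ∈ IAC, s ∉ esupp B := fun s hs h => hcommon s (mem_inter.1 hs).1 h (mem_inter.1 hs).2
  have hIBC_A : ∀ t ∈ IBC, t ∉ esupp A := fun t ht h => hcommon t h (mem_inter.1 ht).1 (mem_inter.1 ht).2
  have hIAB_C : ∀ f ∈ IAB, f ∉ esupp C := fun f hf => hcommon f (mem_inter.1 hf).1 (mem_inter.1 hf).2
  -- the `C`-ignoring section `A'` is non-trivial
  have huniv' : Set.univ ∈ secAt e (!v) A := by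
    cases v
    · exact univ_mem_secAt_true hA hAne e
    · rw [mem_secAt]; simpa only [forceAt, Bool.not_true, cond_false] using hA0
  have hempty' : (∅ : Set ι) ∉ secAt e (!v) A := by
    cases v
    · rw [mem_secAt]; simp only [forceAt, Bool.not_false, cond_true, insert_empty_eq]; exact hNSA e heA
    · rw [mem_secAt]; simp only [forceAt, Bool.not_true, cond_false, Set.empty_sdiff]
      exact fun h => hAnu (Set.eq_univ_of_forall fun η => hA (Set.empty_subset η) h)
  -- `IAC ⊆ esupp (A-section at v)`
  have hIACv : ∀ s ∈ IAC, s ∈ esupp (secAt e v A) := by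
    intro s hs
    have hsC := (mem_inter.1 hs).2
    have hse : s ≠ e := fun hse => heC (hse ▸ hsC)
    rcases mem_esupp_secAt_or (mem_inter.1 hs).1 hse with h | h
    · cases v
      · exact h
      · exact absurd hsC (Finset.disjoint_left.1 hβ h)
    · cases v
      · exact absurd hsC (Finset.disjoint_left.1 hβ h)
      · exact h
  -- Step 1: `IBC ∈ C`
  set R : Set ι := ↑(IAB.erase e) with hR
  have hRC : R ∩ ↑(esupp C) = ∅ := by
    ext i; simp only [hR, Set.mem_inter_iff, mem_coe, mem_erase, Set.mem_empty_iff_false, iff_false, not_and, and_imp]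
    exact fun _ hi hiC => hIAB_C i hi hiC
  have memC : ∀ Y : Set ι, (R ∪ Y ∈ C ↔ Y ∈ C) := by
    intro Y
    refine mem_iff_of_inter_esupp_eq hC ?_
    rw [Set.union_inter_distrib_right, hRC, Set.empty_union]
  have memBv : ∀ Y : Set ι, Y ⊆ ↑(esupp C) → (↑IBC : Set ι) ⊆ Y → R ∪ Y ∈ secAt e v B := by
    intro Y hY hIY
    cases v
    · rw [mem_secAt]; simp only [forceAt, cond_false]
      refine (mem_iff_of_inter_esupp_eq hB (ω' := Set.univ \ {e}) ?_).2 hB0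
      ext f
      simp only [Set.mem_inter_iff, Set.mem_sdiff, Set.mem_union, Set.mem_singleton_iff, mem_coe, Set.mem_univ,
        true_and]
      constructor
      · rintro ⟨⟨_, hfe⟩, hfB⟩; exact ⟨hfe, hfB⟩
      · rintro ⟨hfe, hfB⟩
        refine ⟨⟨?_, hfe⟩, hfB⟩
        rw [esB, mem_union] at hfB
        rcases hfB with hf | hf
        · exact Or.inl (by rw [hR, mem_coe, mem_erase]; exact ⟨hfe, hf⟩)
        · exact Or.inr (hIY hf)
    · rw [mem_secAt]; simp only [forceAt, cond_true]
      refine mem_of_esupp_subset hB hBne ?_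
      intro f hf
      rw [esB, coe_union] at hf
      rcases hf with hf | hf
      · by_cases hfe : f = e
        · rw [hfe]; exact Set.mem_insert e _
        · exact Set.mem_insert_of_mem e (Or.inl (by rw [hR, mem_coe, mem_erase]; exact ⟨hfe, hf⟩))
      · exact Set.mem_insert_of_mem e (Or.inr (hIY hf))
  have hIBCmem : (↑IBC : Set ι) ∈ C :=
    conf_mem_of_pivot_exclusion hC hCne R memC IBC IAC (by rw [esC, union_comm]) _ _ _ _ memBv memBv pbv pbv
      (fun s hs => Or.inl (hIACv s hs))
  -- Step 2: for `s ∈ IAC`, both `s`-minors are realised by the `(A, C)`-section pairs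
  have key : ∀ s ∈ IAC, ∀ b : Bool, ZVia (secAt s b A) (secAt s b C) B := by
    intro s hs b
    have hsA := (mem_inter.1 hs).1
    have hsC := (mem_inter.1 hs).2
    have hse : s ≠ e := fun hse => heC (hse ▸ hsC)
    have hsB : s ∉ esupp B := hIAC_B s hs
    have hm := hmin s (by simp [hsA]) b
    rw [secAt_eq_self_of_not_affects hB (fun h => hsB (mem_esupp.2 h)) b] at hm
    have hAs : IsUpperSet (secAt s b A) := isUpperSet_secAt s b hA
    have hCs : IsUpperSet (secAt s b C) := isUpperSet_secAt s b hC
    -- `IBC ∈ C_s` / `C^s`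
    have hIBCs : (↑IBC : Set ι) ∈ secAt s b C := by
      have hsIBC : s ∉ (↑IBC : Set ι) := fun h => hsB (mem_inter.1 h).1
      cases b
      · exact (mem_secAt_false_iff_of_notMem hsIBC).2 hIBCmem
      · exact subset_secAt_true hC s hIBCmem
    rcases (suppZeroFlag_three_iff_zVia _ _ _).1 hm with h | h | h
    · -- via (B, C-section): the `C`-section ignores `IBC`, contains it, hence contains `∅`
      exfalso
      obtain ⟨dBCs, -, -⟩ := zVia_pivotal hB hCs hAs h
      have h0 : (∅ : Set ι) ∈ secAt s b C := by
        refine (mem_iff_of_inter_esupp_eq hCs (ω := ∅) (ω' := ↑IBC) ?_).2 hIBCs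
        ext i
        simp only [Set.empty_inter, Set.mem_empty_iff_false, Set.mem_inter_iff, mem_coe, false_iff, not_and]
        intro hiBC hiCs
        exact Finset.disjoint_left.1 dBCs (mem_inter.1 hiBC).1 hiCs
      rw [mem_secAt] at h0
      cases b
      · simp only [forceAt, cond_false, Set.empty_sdiff] at h0
        exact hCnu (Set.eq_univ_of_forall fun η => hC (Set.empty_subset η) h0)
      · simp only [forceAt, cond_true, insert_empty_eq] at h0
        exact hNSC s hsC h0
    · exact h
    · -- via (A-section, B): the `A`-section ignores `IAB`; then `A'` is constant
      exfalso
      obtain ⟨dAsB, -, -⟩ := zVia_pivotal hAs hB hCs h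
      have hcomm : secAt e (!v) (secAt s b A) = secAt e (!v) A := by
        rw [secAt_comm (Ne.symm hse)]
        exact secAt_eq_self_of_not_affects hA'u (fun h' => Finset.disjoint_left.1 hβ (mem_esupp.2 h') hsC) b
      have hes : esupp (secAt e (!v) A) = ∅ := by
        rw [Finset.eq_empty_iff_forall_notMem]
        intro f hf
        have hf1 : f ∈ (esupp A).erase e := esupp_secAt_subset hA e (!v) hf
        have hf2 : f ∈ (esupp (secAt s b A)).erase e := by rw [← hcomm] at hf; exact esupp_secAt_subset hAs e (!v) hf
        have hfA := (mem_erase.1 hf1).2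
        rw [esA, mem_union] at hfA
        rcases hfA with hfAB | hfAC
        · exact Finset.disjoint_left.1 dAsB (mem_erase.1 hf2).2 (mem_inter.1 hfAB).2
        · exact Finset.disjoint_left.1 hβ hf (mem_inter.1 hfAC).2
      rcases eq_empty_or_univ_of_esupp_eq_empty hA'u hes with h0 | h1
      · rw [h0] at huniv'; exact huniv'
      · rw [h1] at hempty'; exact hempty' (Set.mem_univ _)
  -- Step 3: `s` is N0 for `(A, C)`; Lemma (αα) for `(A, C, B)`
  obtain ⟨s, hs⟩ := hAC
  have hsA := (mem_inter.1 hs).1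
  have hsC := (mem_inter.1 hs).2
  have hse : s ≠ e := fun hse => heC (hse ▸ hsC)
  have hsB : s ∉ esupp B := hIAC_B s hs
  have hAs0 : Set.univ \ {s} ∈ A := by
    have h1 : Set.univ \ {s} ∈ secAt e (!v) A :=
      univ_diff_mem_of_not_affects hA'u ⟨_, huniv'⟩ (fun h' => Finset.disjoint_left.1 hβ (mem_esupp.2 h') hsC)
    rw [mem_secAt] at h1
    cases v
    · simpa only [forceAt, Bool.not_false, cond_true,
        Set.insert_eq_of_mem (show e ∈ Set.univ \ {s} from ⟨Set.mem_univ e, fun h => hse (Set.mem_singleton_iff.1 h).symm⟩)]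
        using h1
    · simp only [forceAt, Bool.not_true, cond_false] at h1
      exact hA Set.sdiff_subset h1
  have hCs0 : Set.univ \ {s} ∈ C :=
    hC (fun i hi => ⟨Set.mem_univ i, fun his => hsB ((Set.mem_singleton_iff.1 his) ▸ (mem_inter.1 hi).1)⟩) hIBCmem
  have hmin' : ∀ f ∈ esupp A ∩ esupp B, SuppZeroFlag 3 ![secAt f true A, secAt f true C, secAt f true B] := by
    intro f hf
    have hfA := (mem_inter.1 hf).1
    exact (suppZeroFlag_three_swap23 (isUpperSet_secAt f true hA) (isUpperSet_secAt f true hB)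
      (isUpperSet_secAt f true hC)).1 (hmin f (by simp [hfA]) true)
  exact lemma_alpha_alpha hA hC hB hAB (by rwa [union_comm] at hprivA) hprivC hprivB
    (fun i hiA hiC hiB => hcommon i hiA hiB hiC) hNSA hNSB hsA hsC hAs0 hCs0 (key s hs false) (key s hs true) hmin'


end Summit.CriticalPhenomena.PercolationContinuityZ3.Theorems
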